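import Summits.BirchSwinnertonDyer.BirchSwinnertonDyer.Theorems.CMKolyvaginAtInertTwoCMExactDescentAtTwo
import HarnessLib

/-!
# Sibling line `ShiftedKolyvaginAtInertTwo`, crux `ShiftedExactDescentAtTwo` (item stmt-BirchSwinnertonDyer-25537) —
# THE TAMAGAWA-SHIFTED EXACT `2`-ADIC HEEGNER DESCENT
# `t ≤ M₀ ∧ #Ш(E/K)[2^∞] = 2^{2(M₀ − t)} ∧ BSD₂(E^{(d_K)}) ⟹ BSD₂(E)`, `t := ord₂ ∏_ℓ c_ℓ(E/ℚ)`,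
# PROVED modulo the same four published facts as its `t = 0` twin (item 24154)
# (cell `bsd-print-cf2`, typer ty2 = the discharge interface; theorems only)

HONEST FRAMING (cell `bsd-print-cf2`, HOME `run/shared/lean/pub/bsd-print-cf2/`; sibling route
`route-BirchSwinnertonDyer-ShiftedKolyvaginAtInertTwo`, DRAFT rev 3/4 pending its tribunal when this was typed;
item 25537 OPEN, filed «difficulty L»). THEOREMS ONLY — no definition, no named fact, nothing asserted, nothing
booked; BSD is not proved by this and no class of the CM corner at `2` is closed here. The shifted exactness
`#Ш(E/K)[2^∞] = 2^{2(M₀ − t)}` and the index inequality `t ≤ M₀` are INPUTS (the research claims of the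
route's cruxes 25411 `RefinedKolyvaginAtInertTwo` / 25528 `ShiftedKolyvaginExactAtInertTwo`); every theorem
below is CONDITIONAL on four STATEMENT-ONLY published facts taken as binders, none of which has a `_holds`:
Gross–Zagier (`gross_zagier`), Gross–Zagier–Kolyvagin over `ℚ` (`rank_eq_analyticRank_of_analyticRank_le_one`),
modularity (`hasEntireLFunction_rat`) and Milne 1972 Thm 1 in any-model form
(`Milne1972.bsdQuotient_baseChange_quadratic_anyModel`) — exactly the trust base of the `t = 0` twin.

WHAT. Item 25537 is the `t`-twin of the sibling route's crux `CMExactDescentAtTwo` (22837; closed BY NAME through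
its `…OfFacts` twin 24154 by `Theorems.CMExactDescent.cmExactDescentAtTwo_ofFacts`, seat `bsd-line-cmk2-p1`):
the binder `Odd W.tamagawaProduct` is DROPPED, the Kolyvagin output becomes `#Ш(E/K)[2^∞] = 2^{2(M₀ − t)}` with
`t := padicValNat 2 W.tamagawaProduct ≤ M₀`, everything else verbatim. This file proves it in the same currency:

* `bsdp_two_of_card_sha_baseChange_eq_shifted_of_facts` — the CM-free, rank-order-symmetric core (shape of
  `CMExactDescent.bsdp_two_of_card_sha_baseChange_eq_of_facts` with the shift): ANY globally minimal `W/ℚ` with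
  `ρ̄_{E,2}` onto and `r_an(E) ≤ 1`; `K` imaginary quadratic, odd `d_K ≠ −3`, Heegner hypothesis for `N_E`; `Dt`
  with odd Manin constant; `d₁` of conductor `1` with `2^{M₀} ∥ P(1)` in `E(K[1])`; `ord_{s=1} L(E_K,s) = 1`;
  `t ≤ M₀`; `#Ш(E_K)[2^∞] = 2^{2(M₀−t)}`; `Wd` a globally minimal model of `E^{(d_K)}` with `r_an ≤ 1` and
  `BSD(Wd,2)` ⟹ `BSD(W,2)`;
* `…_rankOne` — `r_an(E) = 1`, `y_K = P(1)` non-torsion (the item's shape without its CM / optimality binders);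
* `shiftedExactDescentAtTwo_of_facts` — THE ITEM'S SIGNATURE VERBATIM behind the four fact binders, and
  `shiftedExactDescentAtTwo_ofFacts` — the same behind ONE bundled antecedent
  `(∀ N W K, gross_zagier N W K) ∧ GZK ∧ modularity ∧ Milne`, the `…OfFacts` shape of 24154.

WHY IT IS TURNKEY (and why the item's «why it might fail» does not bite on this road). In the `t = 0` kernel proof
the parity of `∏ c_ℓ` enters at exactly ONE line — the `2`-adic valuation of Dokchitser–Dokchitser's
`#Ш_an(W ⊗ K) = 4·I²/(c²·w_K²·(∏_ℓ c_ℓ)²)` (the exact Gross–Zagier identity over `K`,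
`CMExactDescent.shaAnOverC_baseChange_eq_of_heegner`; `C(W ⊗ K) = (∏ c_ℓ)²` because `W ⊗ K` is globally minimal
and every bad prime splits in `K`). With `ord₂ I = ord₂ [E(K) : ℤP₀] = M₀` (no `2`-power torsion in `E(K[1])`
from `ρ̄_{E,2}` onto and `d_K` odd — `CMExactDescent.eq_zero_of_two_pow_smul_eq_zero_ringClassField`), `w_K = 2`
and `c` odd, that valuation is `2M₀ − 2t` for EVERY `t`; it equals `ord₂ #Ш(E_K) = 2(M₀ − t)` by the two inputs,
which is `AdditivePotMult.MissingPPartOverCAt (W ⊗ K) 2`; and the model-free quadratic descent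
`AdditivePotMult.bsdp_of_pPartOverC_baseChange` (Milne's whole-quotient identity, any model, any reduction type
at `2`) is blind to Tamagawa numbers, real periods and component groups separately — the «stray factor 2 from the
real period or E(ℚ₂)-component group / Kramer–Tunnell norm index» of the item's why-it-might-fail lives inside
that one identity exactly as it did at `t = 0`. In particular the split `2 ∣ N` / `2 ∤ N` of the planner's birth
skeleton (`stub_descentAdditiveTwo`, `stub_descentGoodTwo`; evidence `ShiftedExactDescentAtTwo_birth_v2.lean` on
25537) is not needed: both stubs are instances of `shiftedExactDescentAtTwo_of_facts` (which ignores the reduction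
type at `2`), and the `t = 0` theorem is the instance `Odd ∏c_ℓ ⇒ t = 0`. Not used, as at `t = 0`: `HasCM`,
`CMInert W 2`, the optimality display of `Dt`.

BOOKING NOTE (planner's verb, not this seat's). 25537 as typed has NO named-fact antecedent, so — like 22837 — it
cannot close by name while the four facts are undischarged; the by-name closure goes through a twin
`ShiftedExactDescentAtTwoOfFacts := ((∀ N W K, gross_zagier N W K) ∧ GZK ∧ hasEntireLFunction_rat ∧ Milne) →
ShiftedExactDescentAtTwo` (24154 precedent), whose Theorems/ closer is the one-liner
`theorem … : ShiftedExactDescentAtTwoOfFacts := P2.ShiftedDescent.shiftedExactDescentAtTwo_ofFacts`.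

This module imports the sibling's route-bound closer file for its §1–§4 lemmas (Heegner point below `P(1)`,
no `2`-power torsion over `K[1]`/`K`, the exact identity), which the dedup rule forbids re-declaring; it does NOT
import the draft route's Theses file (the item's signature is spelled out verbatim instead). Imports Summits-side
theorems + Literature only; no instance, no notation, no fact, no `sorry`. Beyond print: NO (the descent step is
Gross–Zagier V.§2 bookkeeping at `p = 2` with the Tamagawa shift carried; W. Zhang's refined index
`𝓜_∞ = ord_p ∏ c_ℓ` is the shape of arXiv:2312.09301 Thm 2 / Jetchev 2008 at odd `p`). BSD is not proved by any
of this.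

References: [GrossZagier1986] B. H. Gross, D. Zagier, *Heegner points and derivatives of L-series*, Invent.
Math. 84 (1986), I.(6.3), V.§2 (pp. 310–312); [GrossLMS1991] §2 Conj. (2.2), §4 (4.1); [McCallumLMS1991] §5
Lemma 5.1; [Milne1972ArithmeticAV] §1 Thm 1; [DokchitserDokchitserAnnals2010] §2.1; [Miller2011LMS] Def. 1.1;
[JetchevKolyvaginTamagawa2008] Conj. 1.3 / Thm 1.4 (the shift `t`); cell DOSSIER §20.2, §21; sibling kit
`HOME/bsd-print-cf2-plan/Sibling-ShiftedKolyvagin/` (Route.md, restate_C.txt).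
-/

set_option autoImplicit false

noncomputable section

open scoped Classical

open WeierstrassCurve NumberField Literature.NumberTheory.EllipticCurves
  Literature.NumberTheory.EllipticCurves.ModularForms
  Literature.NumberTheory.EllipticCurves.Rank1Residual
  Literature.NumberTheory.EllipticCurves.Rank1Residual.Typed
  Literature.NumberTheory.EllipticCurves.KrizLi2019
  Summit.BirchSwinnertonDyer.Rank1Residual
  Summit.BirchSwinnertonDyer.Rank1Residual.AdditivePotMult
  Summit.BirchSwinnertonDyer.BirchSwinnertonDyer.Theorems.CMExactDescent

namespace Summit.BirchSwinnertonDyer.Rank1Residual.P2.ShiftedDescent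

section Core

variable (W : WeierstrassCurve ℚ) [W.IsElliptic] [W.IsGloballyMinimal] [NeZero (W.conductorNorm ℤ)]
  (K : Type) [Field K] [NumberField K]
  (Dt : ModularParametrizationData W (W.conductorNorm ℤ)) (β : ℤ) (ι : K →+* ℂ)
  (d₁ : KolyvaginHeegnerData Dt β ι 1)
  (Wd : WeierstrassCurve ℚ) [Wd.IsElliptic] [Wd.IsGloballyMinimal]

/-! ## §1 The shifted descent, CM-free and symmetric in the rank order -/

/-- **THE TAMAGAWA-SHIFTED EXACT `2`-ADIC HEEGNER DESCENT, CM-free and symmetric in the rank order.**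
`W/ℚ` globally minimal of conductor `N` with `ρ̄_{E,2}` onto (`hρ`) and `r_an(E) ≤ 1` (`hr`) — NO parity
condition on `∏_ℓ c_ℓ(E)`; `K` imaginary quadratic with odd `d_K ≠ −3` (`hK`, `hodd`, `h3`: so `w_K = 2`)
satisfying the Heegner hypothesis for `N` (`hH`); `Dt` a parametrisation datum at level `N` with odd Manin
constant (`hc`); `d₁` a conductor-`1` Kolyvagin datum with `2^{M₀} ∥ P(1) = y_K` in `E(K[1])` (`hdiv`,
`hndiv`); `ord_{s=1} L(E_K, s) = 1` on the model `W ⊗ K` (`hrK`); the SHIFT `t := ord₂ ∏_ℓ c_ℓ ≤ M₀` (`ht`)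
and the shifted Kolyvagin output `#Ш(E_K/K)[2^∞] = 2^{2(M₀ − t)}` (`hsha`); `Wd` a globally minimal model of
`E^{(d_K)}` with `r_an(Wd) ≤ 1` and `BSD(Wd, 2)`. PUBLISHED inputs as binders: `hGZ` (Gross–Zagier at
`(N, W, K)`), `hGZK`, `hmod`, `hMilneC`. CONCLUSION: `BSD(W, 2)`. Proof = the `t = 0` proof
(`CMExactDescent.bsdp_two_of_card_sha_baseChange_eq_of_facts`) with the one valuation line changed: `P(1)`
descends to `P₀ ∈ E(K)` over the Heegner point of `Dt`; `E(K[1])[2^M] = 0` transports `2^{M₀} ∥ P(1)` to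
`2^{M₀} ∥ P₀` in `E(K)` and gives `ord₂ [E(K):ℤP₀] = M₀`; the exact identity
`#Ш_an(W ⊗ K) = 4I²/(c²·w_K²·(∏c_ℓ)²)` then has `ord₂ = 2M₀ − 2t`, which is `ord₂ #Ш(E_K/K) = 2(M₀ − t)` as
`t ≤ M₀`, i.e. `MissingPPartOverCAt (W ⊗ K) 2`; `AdditivePotMult.bsdp_of_pPartOverC_baseChange` concludes.
[cite: GrossZagier1986, V.§2 (pp. 310–312)] [cite: McCallumLMS1991, §5 Lemma 5.1]
[cite: Milne1972ArithmeticAV, §1 Thm. 1] [cite: Miller2011LMS, Def. 1.1] -/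
theorem bsdp_two_of_card_sha_baseChange_eq_shifted_of_facts
    (hGZ : gross_zagier (W.conductorNorm ℤ) W K)
    (hGZK : rank_eq_analyticRank_of_analyticRank_le_one) (hmod : hasEntireLFunction_rat)
    (hMilneC : Milne1972.bsdQuotient_baseChange_quadratic_anyModel)
    (hρ : W.HasSurjectiveModNGaloisRep 2) (hr : W.analyticRank ≤ 1)
    (hK : IsImaginaryQuadratic K) (hodd : Odd (NumberField.discr K)) (h3 : NumberField.discr K ≠ -3)
    (hH : SatisfiesHeegnerHypothesis (W.conductorNorm ℤ) K) (hc : Odd Dt.c)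
    (hrK : (W.baseChange K).analyticRank = 1) {M₀ : ℕ}
    (hdiv : ∃ Q : (W.baseChange (ringClassField K ι 1)).toAffine.Point,
      ((2 ^ M₀ : ℕ) : ℤ) • Q = d₁.derivedPoint)
    (hndiv : ¬ ∃ Q : (W.baseChange (ringClassField K ι 1)).toAffine.Point,
      ((2 ^ (M₀ + 1) : ℕ) : ℤ) • Q = d₁.derivedPoint)
    (ht : padicValNat 2 W.tamagawaProduct ≤ M₀)
    (hsha : Nat.card (AddCommGroup.primaryComponent (W.baseChange K).sha 2) =
      2 ^ (2 * (M₀ - padicValNat 2 W.tamagawaProduct)))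
    (hWd : ∃ C : VariableChange ℚ, C • W.quadraticTwist (NumberField.discr K : ℚ) = Wd)
    (hrd : Wd.analyticRank ≤ 1) (hBd : BSDp Wd 2) : BSDp W 2 := by
  haveI : Fact (Nat.Prime 2) := ⟨Nat.prime_two⟩
  haveI hEK : (W.baseChange K).IsElliptic := isElliptic_baseChange' W K
  have h2 : Module.finrank ℚ K = 2 := hK.1
  obtain ⟨-, hDlt⟩ := discr_emod_four_and_lt_of_odd hK hodd h3
  have hw2 : Units.torsionOrder K = 2 :=
    Literature.NumberTheory.QuadraticFields.Quadratic.torsionOrder_eq_two_of_discr_lt_neg_four h2 hDlt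
  have hc0 : Dt.c ≠ 0 := by
    obtain ⟨k, hk⟩ := hc
    omega
  -- the Heegner point `P₀ ∈ E(K)` below `P(1)`, for the datum `Dt`
  obtain ⟨P₀, Hd, hP₀, hP₀K⟩ := exists_heegnerPoint_map_eq_derivedPoint_one hK hH d₁
  -- the exact identity over `K`
  obtain ⟨hrkK, hShaK, hPinf, hshaC⟩ := shaAnOverC_baseChange_eq_of_heegner W K Dt Hd ι P₀ hGZ
    hGZK hmod hK hH hP₀ hc0 hrK
  haveI hfinK : Finite (W.baseChange K).sha := hShaK
  -- `ord₂ [E(K) : ℤP₀] = M₀`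
  have htor1 : ∀ (M : ℕ) (R : (W.baseChange (ringClassField K ι 1)).toAffine.Point),
      ((2 ^ M : ℕ) : ℤ) • R = 0 → R = 0 :=
    fun M R hR ↦ eq_zero_of_two_pow_smul_eq_zero_ringClassField W hK hodd hH hρ ι M R hR
  have hdivK : ∃ Q : (W.baseChange K).toAffine.Point, ((2 ^ M₀ : ℕ) : ℤ) • Q = P₀ :=
    (X11b.Three.Koly.pDiv_one_iff_exists_zsmul_eq hK d₁ P₀ hP₀K 2 M₀ (htor1 M₀)).mp hdiv
  have hndivK : ¬ ∃ Q : (W.baseChange K).toAffine.Point, ((2 ^ (M₀ + 1) : ℕ) : ℤ) • Q = P₀ :=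
    fun h ↦ hndiv ((X11b.Three.Koly.pDiv_one_iff_exists_zsmul_eq hK d₁ P₀ hP₀K 2 (M₀ + 1)
      (htor1 (M₀ + 1))).mpr h)
  have hiv : ∀ x : (W.baseChange K).toAffine.Point, 2 • x = 0 → x = 0 :=
    fun x hx ↦ eq_zero_of_two_smul_eq_zero_baseChange W hK hodd hH hρ x hx
  haveI : Finite (AddCommGroup.torsion (W.baseChange K).toAffine.Point) :=
    WeierstrassCurve.finite_torsion_point (W := W.baseChange K)
  obtain ⟨cc, Q, hcQ, hcker⟩ :=
    X11b.RankOne.exists_coord_of_mordellWeilRank_eq_one (W.baseChange K) hrkK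
  have hidx : padicValNat 2 (AddSubgroup.zmultiples P₀).index = M₀ :=
    X11b.Three.Koly.padicValNat_index_zmultiples_eq_of_divisibility (p := 2) cc Q hcQ hcker hiv P₀
      hdivK hndivK
  -- `ord₂ #Ш_an(W ⊗ K) = 2 M₀ - 2 t = ord₂ #Ш(W ⊗ K)`
  set I := (AddSubgroup.zmultiples P₀).index with hI_def
  have hI0 : I ≠ 0 := fun hI ↦ by
    have hh := P2.torsionOrder_sq_mul_canonicalHeight_eq_index_sq_mul_regulator (W.baseChange K)
      hrkK P₀ hPinf
    rw [← hI_def, hI, Nat.cast_zero, zero_pow two_ne_zero, zero_mul, mul_eq_zero,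
      pow_eq_zero_iff two_ne_zero, Nat.cast_eq_zero] at hh
    exact hh.elim (W.baseChange K).torsionOrder_pos_holds.ne'
      (fun h0 ↦ hPinf ((Affine.Point.canonicalHeight_eq_zero_iff_holds P₀).mp h0))
  set q : ℚ := 4 * (I : ℚ) ^ 2 /
      ((Dt.c : ℚ) ^ 2 * (Units.torsionOrder K : ℚ) ^ 2 * ((W.tamagawaProduct : ℚ) ^ 2)) with hq_def
  have hcQ0 : (Dt.c : ℚ) ≠ 0 := by exact_mod_cast hc0
  have hcW0 : (W.tamagawaProduct : ℚ) ≠ 0 := by exact_mod_cast W.tamagawaProduct_pos_holds.ne'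
  have hIQ0 : (I : ℚ) ≠ 0 := by exact_mod_cast hI0
  have hq' : q = ((I : ℚ) / ((Dt.c : ℚ) * (W.tamagawaProduct : ℚ))) ^ 2 := by
    rw [hq_def, hw2]
    push_cast
    field_simp
    ring
  have hvc : padicValRat 2 (Dt.c : ℚ) = 0 := by
    rw [padicValRat.of_int, padicValInt.eq_zero_of_not_dvd (fun h2c ↦
      (Int.not_even_iff_odd.mpr hc) (even_iff_two_dvd.mpr h2c))]
    rfl
  -- THE SHIFT: `ord₂ ∏ c_ℓ = t`, no parity hypothesis (the only line that differs from the `t = 0` proof)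
  have hvcW : padicValRat 2 (W.tamagawaProduct : ℚ) = (padicValNat 2 W.tamagawaProduct : ℤ) :=
    padicValRat.of_nat
  have hval : padicValRat 2 q = 2 * (M₀ : ℤ) - 2 * (padicValNat 2 W.tamagawaProduct : ℤ) := by
    rw [hq', padicValRat.pow, padicValRat.div hIQ0 (mul_ne_zero hcQ0 hcW0),
      padicValRat.mul hcQ0 hcW0, hvc, hvcW, padicValRat.of_nat, hidx]
    push_cast
    ring
  have hshaV : padicValNat 2 (W.baseChange K).shaOrder =
      2 * (M₀ - padicValNat 2 W.tamagawaProduct) := by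
    rw [X11b.Three.Koly.padicValNat_shaOrder_eq (W.baseChange K) 2, hsha, padicValNat.prime_pow]
  have hKin : MissingPPartOverCAt (W.baseChange K) 2 :=
    ⟨q, hshaC, by rw [hval, hshaV]; push_cast [Nat.cast_sub ht]; ring⟩
  exact bsdp_of_pPartOverC_baseChange W 2 K Wd hGZK hmod hMilneC hr h2 hWd hrd hKin hBd

/-! ## §2 The rank-one member (the item's shape without its CM / optimality binders) -/

/-- **The rank-ONE member, shifted** (shape of `ShiftedExactDescentAtTwo`, item 25537, without its CM /
optimality binders): `r_an(E) = 1` and `y_K = P(1)` of infinite order; then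
`L′(E/K,1) = L′(E,1)·L(E^{(d_K)},1) ≠ 0` (Gross–Zagier at `P₀`), so `r_an(E^{(d_K)}) = 0`,
`ord_{s=1} L(E_K,s) = 1`, and `bsdp_two_of_card_sha_baseChange_eq_shifted_of_facts` applies.
[cite: GrossZagier1986, V.§2 (p. 312)] [cite: Miller2011LMS, Def. 1.1] -/
theorem bsdp_two_of_card_sha_baseChange_eq_shifted_of_facts_rankOne
    (hGZ : gross_zagier (W.conductorNorm ℤ) W K)
    (hGZK : rank_eq_analyticRank_of_analyticRank_le_one) (hmod : hasEntireLFunction_rat)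
    (hMilneC : Milne1972.bsdQuotient_baseChange_quadratic_anyModel)
    (hρ : W.HasSurjectiveModNGaloisRep 2) (hr : W.analyticRank = 1)
    (hK : IsImaginaryQuadratic K) (hodd : Odd (NumberField.discr K)) (h3 : NumberField.discr K ≠ -3)
    (hH : SatisfiesHeegnerHypothesis (W.conductorNorm ℤ) K) (hc : Odd Dt.c)
    (hy : ¬ IsOfFinAddOrder d₁.derivedPoint) {M₀ : ℕ}
    (hdiv : ∃ Q : (W.baseChange (ringClassField K ι 1)).toAffine.Point,
      ((2 ^ M₀ : ℕ) : ℤ) • Q = d₁.derivedPoint)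
    (hndiv : ¬ ∃ Q : (W.baseChange (ringClassField K ι 1)).toAffine.Point,
      ((2 ^ (M₀ + 1) : ℕ) : ℤ) • Q = d₁.derivedPoint)
    (ht : padicValNat 2 W.tamagawaProduct ≤ M₀)
    (hsha : Nat.card (AddCommGroup.primaryComponent (W.baseChange K).sha 2) =
      2 ^ (2 * (M₀ - padicValNat 2 W.tamagawaProduct)))
    (hWd : ∃ C : VariableChange ℚ, C • W.quadraticTwist (NumberField.discr K : ℚ) = Wd)
    (hBd : BSDp Wd 2) : BSDp W 2 := by
  have h2 : Module.finrank ℚ K = 2 := hK.1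
  have hD0 : (NumberField.discr K : ℚ) ≠ 0 := by exact_mod_cast NumberField.discr_ne_zero K
  haveI hEt : (W.quadraticTwist (NumberField.discr K : ℚ)).IsElliptic :=
    W.isElliptic_quadraticTwist hD0
  obtain ⟨P₀, Hd, hP₀, hP₀K⟩ := exists_heegnerPoint_map_eq_derivedPoint_one hK hH d₁
  have hPinf : ¬ IsOfFinAddOrder P₀ := by
    intro hfin
    apply hy
    rw [← hP₀K]
    exact (WeierstrassCurve.Affine.Point.map (W' := W)
      (algebraMap K (ringClassField K ι 1)).toRatAlgHom).isOfFinAddOrder hfin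
  have hLK : LDerivEK W K ≠ 0 :=
    (lDerivEK_ne_zero_iff_not_isOfFinAddOrder W (W.conductorNorm ℤ) K hGZ hK hH
      ⟨Dt, Hd, ι, hP₀⟩).mpr hPinf
  have hL0 : W.entireLFunction 1 = 0 := entireLFunction_one_eq_zero_of_analyticRank_eq_one hr
  have hLt : (W.quadraticTwist (NumberField.discr K : ℚ)).entireLFunction 1 ≠ 0 := by
    intro h0
    apply hLK
    rw [lDerivEK_eq_deriv_mul W K hmod hL0, h0, mul_zero]
  have hrt : (W.quadraticTwist (NumberField.discr K : ℚ)).analyticRank = 0 :=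
    ((W.quadraticTwist _).analyticRank_eq_zero_iff_holds (hmod _)).mpr hLt
  have hrd : Wd.analyticRank = 0 := by
    obtain ⟨Cd, hCd⟩ := hWd
    rw [← hCd, analyticRank_smul, hrt]
  have hrK : (W.baseChange K).analyticRank = 1 :=
    (P2.analyticRank_baseChange_eq_one_iff W K hmod h2).mpr (Or.inl ⟨hr, hrt⟩)
  exact bsdp_two_of_card_sha_baseChange_eq_shifted_of_facts W K Dt β ι d₁ Wd hGZ hGZK hmod hMilneC hρ
    hr.le hK hodd h3 hH hc hrK hdiv hndiv ht hsha hWd (by rw [hrd]; exact zero_le_one) hBd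

end Core

/-! ## §3 Item 25537 verbatim, modulo the four published facts -/

/-- **`ShiftedExactDescentAtTwo` (item stmt-BirchSwinnertonDyer-25537, signature VERBATIM) MODULO ITS FOUR
PUBLISHED INPUTS** `hGZ` (Gross–Zagier, all `(N, W, K)`), `hGZK` (Gross–Zagier–Kolyvagin over `ℚ`), `hmod`
(modularity), `hMilneC` (Milne 1972 Thm 1, any model): the rank-one member §2 on the item's binders. The CM
hypotheses (`HasCM`, `CMInert W 2`) and the optimality display of `Dt` are not used. CONDITIONAL on the four
named facts (none has a `_holds`); closes item 25537 only through an `…OfFacts` twin (§3, next theorem).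
[cite: GrossZagier1986, V.§2 (pp. 310–312)] [cite: Milne1972ArithmeticAV, §1 Thm. 1]
[cite: McCallumLMS1991, §5 Lemma 5.1] [cite: Miller2011LMS, Def. 1.1] -/
theorem shiftedExactDescentAtTwo_of_facts
    (hGZ : ∀ (N : ℕ) [NeZero N] (W : WeierstrassCurve ℚ) (K : Type) [Field K] [NumberField K],
      gross_zagier N W K)
    (hGZK : rank_eq_analyticRank_of_analyticRank_le_one) (hmod : hasEntireLFunction_rat)
    (hMilneC : Milne1972.bsdQuotient_baseChange_quadratic_anyModel) :
    ∀ (W : WeierstrassCurve ℚ) [W.IsElliptic] [W.IsGloballyMinimal] [NeZero (W.conductorNorm ℤ)], W.HasCM →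
      Literature.NumberTheory.EllipticCurves.Rank1Residual.CMInert W 2 →
      W.HasSurjectiveModNGaloisRep (2 : ℤ) → W.analyticRank = 1 →
      ∀ (K : Type) [Field K] [NumberField K], Literature.NumberTheory.EllipticCurves.IsImaginaryQuadratic K →
      Odd (NumberField.discr K) → NumberField.discr K ≠ -3 →
      Literature.NumberTheory.EllipticCurves.SatisfiesHeegnerHypothesis (W.conductorNorm ℤ) K →
      ∀ (Dt : Literature.NumberTheory.EllipticCurves.ModularForms.ModularParametrizationData W
        (W.conductorNorm ℤ)),
      (∀ z ∈ Dt.L.lattice, ∃ w ∈ Literature.NumberTheory.EllipticCurves.ModularForms.periodLattice Dt.f,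
        z = (Dt.c : ℂ) * w) → Odd Dt.c →
      ∀ (β : ℤ) (ι : K →+* ℂ) (d₁ : Literature.NumberTheory.EllipticCurves.KolyvaginHeegnerData Dt β ι 1),
      ¬ IsOfFinAddOrder d₁.derivedPoint →
      ∀ (M₀ : ℕ), (∃ Q : (W.baseChange
          (Literature.NumberTheory.EllipticCurves.ringClassField K ι 1)).toAffine.Point,
        ((2 ^ M₀ : ℕ) : ℤ) • Q = d₁.derivedPoint) →
      (¬ ∃ Q : (W.baseChange
          (Literature.NumberTheory.EllipticCurves.ringClassField K ι 1)).toAffine.Point,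
        ((2 ^ (M₀ + 1) : ℕ) : ℤ) • Q = d₁.derivedPoint) →
      padicValNat 2 W.tamagawaProduct ≤ M₀ →
      Nat.card (AddCommGroup.primaryComponent (W.baseChange K).sha 2) =
        2 ^ (2 * (M₀ - padicValNat 2 W.tamagawaProduct)) →
      ∀ (Wd : WeierstrassCurve ℚ) [Wd.IsElliptic] [Wd.IsGloballyMinimal],
      (∃ C : WeierstrassCurve.VariableChange ℚ, C • W.quadraticTwist (NumberField.discr K : ℚ) = Wd) →
      Literature.NumberTheory.EllipticCurves.BSDp Wd 2 →
      Literature.NumberTheory.EllipticCurves.BSDp W 2 := by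
  intro W _ _ _ _hcm _hin hρ hr K _ _ hK hodd h3 hH Dt _hopt hc β ι d₁ hy M₀ hdiv hndiv ht hsha Wd _ _
    hWd hBd
  exact bsdp_two_of_card_sha_baseChange_eq_shifted_of_facts_rankOne W K Dt β ι d₁ Wd (hGZ _ W K) hGZK
    hmod hMilneC hρ hr hK hodd h3 hH hc hy hdiv hndiv ht hsha hWd hBd

/-- **The item RELATIVE TO its named-fact bundle** (the cell's `…OfFacts` shape; twin of
`CMExactDescent.cmExactDescentAtTwo_ofFacts`, closer of 24154): `(∀ N W K, gross_zagier N W K) ∧ GZK ∧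
modularity ∧ Milne any-model → ShiftedExactDescentAtTwo` (signature verbatim) — the statement a by-name
closer of a twin item `ShiftedExactDescentAtTwoOfFacts` proves by this constant.
[cite: Miller2011LMS, Def. 1.1] -/
theorem shiftedExactDescentAtTwo_ofFacts :
    ((∀ (N : ℕ) [NeZero N] (W : WeierstrassCurve ℚ) (K : Type) [Field K] [NumberField K],
        gross_zagier N W K) ∧
      rank_eq_analyticRank_of_analyticRank_le_one ∧ hasEntireLFunction_rat ∧
      Milne1972.bsdQuotient_baseChange_quadratic_anyModel) →
    ∀ (W : WeierstrassCurve ℚ) [W.IsElliptic] [W.IsGloballyMinimal] [NeZero (W.conductorNorm ℤ)], W.HasCM →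
      Literature.NumberTheory.EllipticCurves.Rank1Residual.CMInert W 2 →
      W.HasSurjectiveModNGaloisRep (2 : ℤ) → W.analyticRank = 1 →
      ∀ (K : Type) [Field K] [NumberField K], Literature.NumberTheory.EllipticCurves.IsImaginaryQuadratic K →
      Odd (NumberField.discr K) → NumberField.discr K ≠ -3 →
      Literature.NumberTheory.EllipticCurves.SatisfiesHeegnerHypothesis (W.conductorNorm ℤ) K →
      ∀ (Dt : Literature.NumberTheory.EllipticCurves.ModularForms.ModularParametrizationData W
        (W.conductorNorm ℤ)),
      (∀ z ∈ Dt.L.lattice, ∃ w ∈ Literature.NumberTheory.EllipticCurves.ModularForms.periodLattice Dt.f,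
        z = (Dt.c : ℂ) * w) → Odd Dt.c →
      ∀ (β : ℤ) (ι : K →+* ℂ) (d₁ : Literature.NumberTheory.EllipticCurves.KolyvaginHeegnerData Dt β ι 1),
      ¬ IsOfFinAddOrder d₁.derivedPoint →
      ∀ (M₀ : ℕ), (∃ Q : (W.baseChange
          (Literature.NumberTheory.EllipticCurves.ringClassField K ι 1)).toAffine.Point,
        ((2 ^ M₀ : ℕ) : ℤ) • Q = d₁.derivedPoint) →
      (¬ ∃ Q : (W.baseChange
          (Literature.NumberTheory.EllipticCurves.ringClassField K ι 1)).toAffine.Point,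
        ((2 ^ (M₀ + 1) : ℕ) : ℤ) • Q = d₁.derivedPoint) →
      padicValNat 2 W.tamagawaProduct ≤ M₀ →
      Nat.card (AddCommGroup.primaryComponent (W.baseChange K).sha 2) =
        2 ^ (2 * (M₀ - padicValNat 2 W.tamagawaProduct)) →
      ∀ (Wd : WeierstrassCurve ℚ) [Wd.IsElliptic] [Wd.IsGloballyMinimal],
      (∃ C : WeierstrassCurve.VariableChange ℚ, C • W.quadraticTwist (NumberField.discr K : ℚ) = Wd) →
      Literature.NumberTheory.EllipticCurves.BSDp Wd 2 →
      Literature.NumberTheory.EllipticCurves.BSDp W 2 :=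
  fun h ↦ shiftedExactDescentAtTwo_of_facts h.1 h.2.1 h.2.2.1 h.2.2.2

end Summit.BirchSwinnertonDyer.Rank1Residual.P2.ShiftedDescent

end
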